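import Summits.AtomisticToContinuum.HydrodynamicLimit.Theorems.OneFlightGossipEngineClampedCurrentsDockCutoff
import Literature.Analysis.UnboundedOperators.LinearizedBoltzmannBurnettBProofs
import Literature.Probability.Distributions.GaussianPolynomialDensity
import HarnessLib

/-!
# The quantitative low-speed heat-flux cut-off (registered sub-goal `tailRate_cutoffQuant`, stub `stub_tailRateWindowClause`,
# line `tail-rate`, crux `TwoClocks.TransferEntropyClock`, stmt-AtomisticToContinuum-16625)

Helper file 1/4 (`--supports stmt-AtomisticToContinuum-16625`) of the stub `stub_tailRateWindowClause : TailRateWindowClause`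
(Yau's one-window ledger at a rate with the kinetic cut-off taken at the TAIL level). The line's kinetic node has the tilt law
`β₁/C`, `C` the quadratic-growth constant of the class member, so the Grönwall rate is `≍ C(K₁)` and must be beaten by the cubic
velocity tails `e^{-c′K₁}`: this needs a cut-off `G_{K}` of `s′ − 5θ` whose growth constant is LINEAR in `K`, all constants explicit.
The landed `ClampedCurrentsDockCutoffFamily.cutoff_param` (crux 14680) re-orthogonalises with a tent placed ABOVE `K²/θ_min` in the
reduced variable (amplitude = a ratio of Gaussian tails at different temperatures, `≍ e^{K²(1/θm − 1/θM)/2}`). Here the tent sits in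
the BULK (`[1,3]` in the reduced variable): the reference moment `m₀` is universal and the amplitude `ρ(p) = R(p)/m₀` is a Gaussian
TAIL, since `R(p) = E[ξ₀²(θ‖ξ‖² − 5θ)χ_{K²}(θ‖ξ‖²)] = −E[ξ₀²(θ‖ξ‖² − 5θ)(1 − χ_{K²})]` by the Euler orthogonality `E[ξ₀²(‖ξ‖² − 5)] = 0`
(tree `integral_inner_sq_mul_norm_sq_sub`); so `|ρ| ≤ Cρ(A)e^{-AK}` for EVERY rate `A` (exponential-linear Gaussian moments by
Fernique, tree `integrable_exp_mul_norm_stdGaussian`). Price: `G_K` agrees with `s′ − 5θ` below `K²` only up to `Cρ e^{-AK}` —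
harmless in the cubic channel (file 3/4). prover-line-stmt-AtomisticToContinuum-16625-c5-0 (stub worker `stub_tailRateWindowClause`).
-/

noncomputable section

open MeasureTheory Filter Set Topology
open scoped ENNReal

namespace Summit.AtomisticToContinuum.HydrodynamicLimit.Theorems.TransferEntropyClockTailRateCutoff

open Literature.MathematicalPhysics.KineticTheory Literature.Analysis.FluidPDE Literature.Analysis.FunctionSpaces
open ProbabilityTheory
open Summit.AtomisticToContinuum.HydrodynamicLimit.Theorems.KineticCurrentsWindowLDUniformSketch.ClassTruncation
open Summit.AtomisticToContinuum.HydrodynamicLimit.Theorems.ClampedCurrentsDockCutoff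
  (cutoff_eq_one tent_props isOpenPosMeasure_stdGaussian_V3 odd_member_orth)

/-! ## §2 Gaussian facts for the quantitative cut-off -/

/-- The Euler orthogonality of the heat-flux profile in the reduced Gaussian variable: `E[ξ₀² (‖ξ‖² − 5)] = 0` under the
standard Gaussian on `ℝ³` (`E ξ₀⁴ + 2 E ξ₀²ξ₁² = 3 + 2 = 5 = 5 E ξ₀²`; the instance `i = 0`, `d = 3` of the tree's
`integral_inner_sq_mul_norm_sq_sub`). [folklore] -/
theorem integral_coord_sq_mul_norm_sq_sub_five : ∫ ξ : V3, ξ 0 * ξ 0 * (‖ξ‖ ^ 2 - 5) ∂stdGaussian V3 = 0 := by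
  have h := Literature.Analysis.UnboundedOperators.integral_inner_sq_mul_norm_sq_sub
    (EuclideanSpace.basisFun (Fin 3) ℝ) (0 : Fin 3)
  have hfin : (Module.finrank ℝ V3 : ℝ) = 3 := by rw [finrank_euclideanSpace_fin]; norm_num
  rw [hfin] at h
  have e : ∀ ξ : V3, ξ 0 * ξ 0 * (‖ξ‖ ^ 2 - 5) =
      (inner ℝ ((EuclideanSpace.basisFun (Fin 3) ℝ) 0) ξ) ^ 2 * (‖ξ‖ ^ 2 - (3 + 2)) := by
    intro ξ; rw [EuclideanSpace.basisFun_apply, EuclideanSpace.inner_single_left]; simp; ring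
  simp_rw [e]; exact h

/-- A sextic polynomial weight against an exponential-linear one is dominated by a pure exponential-linear weight:
`(1 + ‖ξ‖²)³ e^{a‖ξ‖} ≤ 799 e^{(a+1)‖ξ‖}` (`xⁿ ≤ n! eˣ`). [folklore] -/
theorem one_add_norm_sq_cube_mul_exp_le (a : ℝ) (ξ : V3) :
    (1 + ‖ξ‖ ^ 2) ^ 3 * Real.exp (a * ‖ξ‖) ≤ 799 * Real.exp ((a + 1) * ‖ξ‖) := by
  have hx : 0 ≤ ‖ξ‖ := norm_nonneg ξ
  have h2 := Real.pow_div_factorial_le_exp ‖ξ‖ hx 2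
  have h4 := Real.pow_div_factorial_le_exp ‖ξ‖ hx 4
  have h6 := Real.pow_div_factorial_le_exp ‖ξ‖ hx 6
  simp only [Nat.factorial, Nat.succ_eq_add_one, Nat.cast_mul, Nat.cast_one] at h2 h4 h6
  norm_num at h2 h4 h6
  have h0 : (1 : ℝ) ≤ Real.exp ‖ξ‖ := Real.one_le_exp hx
  have hpoly : (1 + ‖ξ‖ ^ 2) ^ 3 ≤ 799 * Real.exp ‖ξ‖ := by
    rw [show (1 + ‖ξ‖ ^ 2) ^ 3 = 1 + 3 * ‖ξ‖ ^ 2 + 3 * ‖ξ‖ ^ 4 + ‖ξ‖ ^ 6 by ring]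
    rw [div_le_iff₀ (by norm_num)] at h2 h4 h6
    linarith
  calc (1 + ‖ξ‖ ^ 2) ^ 3 * Real.exp (a * ‖ξ‖) ≤ 799 * Real.exp ‖ξ‖ * Real.exp (a * ‖ξ‖) :=
        mul_le_mul_of_nonneg_right hpoly (Real.exp_pos _).le
    _ = 799 * Real.exp ((a + 1) * ‖ξ‖) := by rw [mul_assoc, ← Real.exp_add]; ring_nf

/-- The exponential-linear tail weight `(1 + ‖ξ‖²)³ e^{a‖ξ‖}` is integrable under the standard Gaussian on `ℝ³`
(Fernique, through the tree's `integrable_exp_mul_norm_stdGaussian`). [folklore] -/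
theorem integrable_tailWeight (a : ℝ) :
    Integrable (fun ξ : V3 => (1 + ‖ξ‖ ^ 2) ^ 3 * Real.exp (a * ‖ξ‖)) (stdGaussian V3) := by
  refine ((Literature.Probability.Distributions.integrable_exp_mul_norm_stdGaussian (a + 1)).const_mul 799).mono'
    (by fun_prop) (ae_of_all _ fun ξ => ?_)
  rw [Real.norm_of_nonneg (by positivity)]
  exact one_add_norm_sq_cube_mul_exp_le a ξ

/-- The indicator of the suprathermal shell in the reduced variable is dominated by an exponential-linear weight at any
rate: if `0 < θ ≤ θM` and `K² ≤ θ ‖ξ‖²` then `1 ≤ exp(A √θM ‖ξ‖ − A K)` for `A ≥ 0`. [folklore] -/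
theorem one_le_exp_rate_of_sq_le {θ θM K A : ℝ} (hθ : 0 < θ) (hθM : θ ≤ θM) (hA : 0 ≤ A) (ξ : V3)
    (h : K ^ 2 ≤ θ * ‖ξ‖ ^ 2) : 1 ≤ Real.exp (A * Real.sqrt θM * ‖ξ‖ - A * K) := by
  have h1 : K ≤ Real.sqrt θ * ‖ξ‖ := by
    rw [← show Real.sqrt (θ * ‖ξ‖ ^ 2) = Real.sqrt θ * ‖ξ‖ by rw [Real.sqrt_mul hθ.le, Real.sqrt_sq (norm_nonneg _)]]
    exact Real.le_sqrt_of_sq_le h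
  have h2 : Real.sqrt θ * ‖ξ‖ ≤ Real.sqrt θM * ‖ξ‖ :=
    mul_le_mul_of_nonneg_right (Real.sqrt_le_sqrt hθM) (norm_nonneg _)
  have h3 : A * K ≤ A * Real.sqrt θM * ‖ξ‖ := by
    rw [mul_assoc]; exact mul_le_mul_of_nonneg_left (h1.trans h2) hA
  exact Real.one_le_exp (by linarith)

/-- Bookkeeping of the linear-in-`K` growth: `x(2Kx + a) ≤ (2K + a)(2 + 2U²)(1 + y²)` when `x² ≤ 2y² + 2U²`
(`x = ‖v − u‖`, `y = ‖v‖`). [folklore] -/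
theorem growth_arith {x y K a U : ℝ} (_hx : 0 ≤ x) (hK : 0 ≤ K) (ha : 0 ≤ a) (hxy : x ^ 2 ≤ 2 * y ^ 2 + 2 * U ^ 2) :
    x * (2 * K * x + a) ≤ (2 * K + a) * ((2 + 2 * U ^ 2) * (1 + y ^ 2)) := by
  have h1 : x ≤ 1 + x ^ 2 := by nlinarith [sq_nonneg (x - 1)]
  have h2 : a * x ≤ a * (1 + x ^ 2) := mul_le_mul_of_nonneg_left h1 ha
  have h3 : 1 + x ^ 2 ≤ (2 + 2 * U ^ 2) * (1 + y ^ 2) := by nlinarith [mul_nonneg (sq_nonneg U) (sq_nonneg y)]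
  have h4 : (2 * K + a) * (1 + x ^ 2) ≤ (2 * K + a) * ((2 + 2 * U ^ 2) * (1 + y ^ 2)) :=
    mul_le_mul_of_nonneg_left h3 (by positivity)
  nlinarith [mul_nonneg hK (sq_nonneg x)]

/-! ## §3 The quantitative re-orthogonalised cut-off over a parameter space -/

/-- registered sub-goal signature `tailRate_cutoffQuant` of line tail-rate, crux TransferEntropyClock (stmt-AtomisticToContinuum-16625):
**the quantitative low-speed heat-flux cut-off over a first-countable parameter space** — for a continuous `θ : X → ℝ` with
`0 < θ ≤ θM`, fields `u b : X → V3` with `‖u‖ ≤ U`, `‖b‖ ≤ Bb`: there is `C₂ ≥ 0` and, for every rate `A > 0`, an amplitude `Cρ ≥ 0`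
such that for every level `K ≥ 1` there is a continuous profile `G(p, s)`, bounded on `s ≥ 0`, with (i) remainder
`|s − 5θ(p) − G(p,s)| ≤ Cρ e^{-AK}` for `0 ≤ s ≤ K²` and `≤ |s − 5θ(p)| + Cρ e^{-AK}` for `s > K²`; (ii) `(b(p)·w) G(p,|w|²)`,
`w = v − u(p)`, of quadratic growth `2Bb(2+2U²)·K + C₂` — LINEAR in `K`; (iii) orthogonal to `1, v_k, ‖v‖²` under `M_{1,u(p),θ(p)}`
at every `p` — route-internal, not a cited fact -/
def CutoffQuant : Prop :=
  ∀ {X : Type} [TopologicalSpace X] [FirstCountableTopology X] {θ : X → ℝ}, Continuous θ → ∀ (u b : X → V3) {θM U Bb : ℝ},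
    (∀ p, 0 < θ p) → 0 < θM → (∀ p, θ p ≤ θM) → (∀ p, ‖u p‖ ≤ U) → 0 ≤ Bb → (∀ p, ‖b p‖ ≤ Bb) →
    ∃ C₂ : ℝ, 0 ≤ C₂ ∧ ∀ A : ℝ, 0 < A → ∃ Cρ : ℝ, 0 ≤ Cρ ∧ ∀ K : ℝ, 1 ≤ K →
    ∃ G : X × ℝ → ℝ, Continuous G ∧
      (∃ C : ℝ, ∀ y : X × ℝ, 0 ≤ y.2 → |G y| ≤ C) ∧
      (∀ (p : X) (s : ℝ), 0 ≤ s → s ≤ K ^ 2 → |s - 5 * θ p - G (p, s)| ≤ Cρ * Real.exp (-(A * K))) ∧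
      (∀ (p : X) (s : ℝ), K ^ 2 < s → |s - 5 * θ p - G (p, s)| ≤ |s - 5 * θ p| + Cρ * Real.exp (-(A * K))) ∧
      (∀ (p : X) (v : V3), |(∑ j : Fin 3, b p j * (v - u p) j) * G (p, ‖v - u p‖ ^ 2)| ≤
        (2 * Bb * (2 + 2 * U ^ 2) * K + C₂) * (1 + ‖v‖ ^ 2)) ∧
      (∀ p, ∫ v, ((∑ j : Fin 3, b p j * (v - u p) j) * G (p, ‖v - u p‖ ^ 2)) *
        localMaxwellian 1 (θ p) (u p) v = 0) ∧
      (∀ p (k : Fin 3), ∫ v, ((∑ j : Fin 3, b p j * (v - u p) j) * G (p, ‖v - u p‖ ^ 2)) * v k *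
        localMaxwellian 1 (θ p) (u p) v = 0) ∧
      (∀ p, ∫ v, ((∑ j : Fin 3, b p j * (v - u p) j) * G (p, ‖v - u p‖ ^ 2)) * ‖v‖ ^ 2 *
        localMaxwellian 1 (θ p) (u p) v = 0)

-- adapted from Summits/.../OneFlightGossipEngineClampedCurrentsDockCutoffFamily.lean (`cutoff_param`): tent moved to the BULK
/-- **`tailRate_cutoffQuant : CutoffQuant`.** Construction `G(p,s) = (s − 5θ(p))χ_{K²}(s) − ρ(p) r₀(s/θ(p))` with the tent `r₀` on
`[1,3]` in the reduced variable and `ρ = R/m₀`, `R(p) = E[ξ₀²(θ‖ξ‖² − 5θ)χ_{K²}(θ‖ξ‖²)] = −E[ξ₀²(θ‖ξ‖² − 5θ)(1 − χ_{K²}(θ‖ξ‖²))]`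
(Euler orthogonality `E[ξ₀²(‖ξ‖² − 5)] = 0`), a Gaussian tail `≤ 5θM E[(1+‖ξ‖²)³e^{A√θM‖ξ‖}] e^{-AK}`. [folklore] -/
theorem tailRate_cutoffQuant : CutoffQuant := by
  intro X _ _ θ hθc u b θM U Bb hθpos hθM0 hθM hU hBb0 hBb
  /- Step 1 (level-free): the tent `r₀` on `[1, 3]`, the reference moment `m₀ = E[ξ₀² r₀(‖ξ‖²)] > 0`, the sextic moment. -/
  set r₀ : ℝ → ℝ := fun t => max 0 (1 - |t - (1 + 1)|) with hr₀
  obtain ⟨hr₀c, hr₀0, hr₀1, hr₀lo, hr₀hi, hr₀one⟩ := tent_props 1 (r := r₀) fun t => by rw [hr₀]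
  clear_value r₀
  have hr₀abs : ∀ t, 0 ≤ t → |r₀ t| ≤ 1 * (1 + t) := fun t ht =>
    le_mul_one_add (by rw [abs_of_nonneg (hr₀0 t)]; exact hr₀1 t) zero_le_one ht
  have hir₀ : Integrable (fun ξ : V3 => ξ 0 * ξ 0 * r₀ (‖ξ‖ ^ 2)) (stdGaussian V3) :=
    integrable_coord_mul_weight 0 0 hr₀c hr₀abs
  set m₀ : ℝ := ∫ ξ, ξ 0 * ξ 0 * r₀ (‖ξ‖ ^ 2) ∂stdGaussian V3 with hm₀def
  have hm₀ : 0 < m₀ := by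
    haveI := isOpenPosMeasure_stdGaussian_V3
    have hpt : (EuclideanSpace.single (0 : Fin 3) (Real.sqrt (1 + 1)) : V3) 0 = Real.sqrt (1 + 1) := by
      simp
    have hn : ‖(EuclideanSpace.single (0 : Fin 3) (Real.sqrt (1 + 1)) : V3)‖ ^ 2 = 1 + 1 := by
      rw [PiLp.norm_single, Real.norm_eq_abs, sq_abs, Real.sq_sqrt (by positivity)]
    rw [hm₀def]
    refine integral_pos_of_integrable_nonneg_nonzero
      (x := (EuclideanSpace.single (0 : Fin 3) (Real.sqrt (1 + 1)) : V3)) (by fun_prop) hir₀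
      (fun ξ => mul_nonneg (mul_self_nonneg _) (hr₀0 _)) ?_
    beta_reduce
    rw [hpt, hn, hr₀one, mul_one, Real.mul_self_sqrt (by positivity)]
    positivity
  clear_value m₀
  set M₃ : ℝ := ∫ ξ : V3, (1 + ‖ξ‖ ^ 2) ^ 3 ∂stdGaussian V3 with hM₃
  have hM₃0 : 0 ≤ M₃ := integral_nonneg fun ξ => by positivity
  clear_value M₃
  -- the level-free amplitude bound `ρM` (for the growth constant) and the constant `C₂`
  set ρM : ℝ := 1 * 1 * (5 * θM) * M₃ / m₀ with hρMdef
  have hρM0 : 0 ≤ ρM := by positivity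
  clear_value ρM
  refine ⟨Bb * (2 + 2 * U ^ 2) * (5 * θM + ρM), by positivity, fun A hA => ?_⟩
  /- Step 2 (rate `A`): the exponential-linear tail moment and the amplitude `Cρ`. -/
  set Mexp : ℝ := ∫ ξ : V3, (1 + ‖ξ‖ ^ 2) ^ 3 * Real.exp (A * Real.sqrt θM * ‖ξ‖) ∂stdGaussian V3 with hMexp
  have hMexp0 : 0 ≤ Mexp := integral_nonneg fun ξ => by positivity
  clear_value Mexp
  refine ⟨5 * θM * Mexp / m₀, by positivity, fun K hK => ?_⟩
  have hK0 : 0 ≤ K := zero_le_one.trans hK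
  /- Step 3 (level `K`): the cutoff `χ = χ_L`, `L = K²`. -/
  set L : ℝ := K ^ 2 with hL
  have hL0 : 0 < L := by positivity
  set χ : ℝ → ℝ := fun s => min 1 (max 0 (2 - s / L)) with hχ
  have hχlo : ∀ s, s ≤ L → χ s = 1 := cutoff_eq_one hL0 (χ := χ) fun s => by rw [hχ]
  obtain ⟨hχc, hχ0, hχ1, hχhi, -⟩ := cutoff_props hL0 (χ := χ) fun s => by rw [hχ]
  clear_value χ
  have h1χ : ∀ s, |1 - χ s| ≤ 1 := fun s => by rw [abs_of_nonneg (sub_nonneg.2 (hχ1 _))]; linarith [hχ0 s]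
  -- the truncated profile: crude bound (for the sup bound) and linear-growth bound (level-free, for the moments)
  have hq : ∀ p s, 0 ≤ s → |(s - 5 * θ p) * χ s| ≤ 2 * L + 5 * θM := by
    intro p s hs
    by_cases h : s ≤ 2 * L
    · rw [abs_mul, abs_of_nonneg (hχ0 s)]
      calc |s - 5 * θ p| * χ s ≤ |s - 5 * θ p| * 1 :=
            mul_le_mul_of_nonneg_left (hχ1 s) (abs_nonneg _)
        _ ≤ 2 * L + 5 * θM := by
            rw [mul_one]
            refine (abs_sub _ _).trans ?_
            rw [abs_of_nonneg hs, abs_of_nonneg (by have := hθpos p; positivity)]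
            linarith [hθM p]
    · rw [hχhi s (not_le.1 h).le, mul_zero, abs_zero]; positivity
  have hGM0 : 0 ≤ 2 * L + 5 * θM := by positivity
  have hlin : ∀ p t, 0 ≤ t → |θ p * t - 5 * θ p| ≤ 5 * θM * (1 + t) := by
    intro p t ht
    have h0 := hθpos p
    refine (abs_sub _ _).trans ?_
    rw [abs_of_nonneg (by positivity), abs_of_nonneg (by positivity)]
    nlinarith [hθM p]
  have hqlin : ∀ p t, 0 ≤ t → |(θ p * t - 5 * θ p) * χ (θ p * t)| ≤ 5 * θM * (1 + t) := by
    intro p t ht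
    rw [abs_mul, abs_of_nonneg (hχ0 _)]
    calc |θ p * t - 5 * θ p| * χ (θ p * t) ≤ |θ p * t - 5 * θ p| * 1 :=
          mul_le_mul_of_nonneg_left (hχ1 _) (abs_nonneg _)
      _ ≤ 5 * θM * (1 + t) := by rw [mul_one]; exact hlin p t ht
  have hbd : ∀ (p : X) (ξ : V3),
      |ξ 0 * ξ 0 * ((θ p * ‖ξ‖ ^ 2 - 5 * θ p) * χ (θ p * ‖ξ‖ ^ 2))| ≤
        1 * 1 * (5 * θM) * (1 + ‖ξ‖ ^ 2) ^ 3 := fun p ξ =>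
    abs_mul_three_le (abs_coord_le' ξ 0) (abs_coord_le' ξ 0) (hqlin p _ (sq_nonneg _))
  /- Step 4: the truncated moment `R` (continuous by dominated convergence), its level-free bound, the amplitude `ρ = R/m₀`. -/
  set R : X → ℝ := fun p => ∫ ξ, ξ 0 * ξ 0 *
    ((θ p * ‖ξ‖ ^ 2 - 5 * θ p) * χ (θ p * ‖ξ‖ ^ 2)) ∂stdGaussian V3 with hR
  have hRc : Continuous R := by
    refine continuous_of_dominated
      (bound := fun ξ : V3 => 1 * 1 * (5 * θM) * (1 + ‖ξ‖ ^ 2) ^ 3)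
      (fun p => (by fun_prop : Continuous fun ξ : V3 => ξ 0 * ξ 0 *
        ((θ p * ‖ξ‖ ^ 2 - 5 * θ p) * χ (θ p * ‖ξ‖ ^ 2))).aestronglyMeasurable)
      (fun p => ae_of_all _ fun ξ => ?_) (integrable_one_add_norm_sq_cube.const_mul _)
      (ae_of_all _ fun ξ => by fun_prop)
    rw [Real.norm_eq_abs]
    exact hbd p ξ
  have hRbd : ∀ p, |R p| ≤ 1 * 1 * (5 * θM) * M₃ := by
    intro p
    have h := norm_integral_le_of_norm_le (μ := stdGaussian V3)
      (f := fun ξ : V3 => ξ 0 * ξ 0 * ((θ p * ‖ξ‖ ^ 2 - 5 * θ p) * χ (θ p * ‖ξ‖ ^ 2)))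
      (integrable_one_add_norm_sq_cube.const_mul (1 * 1 * (5 * θM)))
      (ae_of_all (stdGaussian V3) fun ξ => by rw [Real.norm_eq_abs]; exact hbd p ξ)
    rw [Real.norm_eq_abs, integral_const_mul, ← hM₃] at h
    rw [hR]
    exact h
  -- the TAIL bound on `R`: Euler orthogonality and the exponential-linear domination of the shell `θ‖ξ‖² ≥ L`
  have hRtail : ∀ p, |R p| ≤ 5 * θM * Mexp * Real.exp (-(A * K)) := by
    intro p
    have h0 := hθpos p
    have hfull : ∫ ξ : V3, ξ 0 * ξ 0 * (θ p * ‖ξ‖ ^ 2 - 5 * θ p) ∂stdGaussian V3 = 0 := by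
      have e : ∀ ξ : V3, ξ 0 * ξ 0 * (θ p * ‖ξ‖ ^ 2 - 5 * θ p) = θ p * (ξ 0 * ξ 0 * (‖ξ‖ ^ 2 - 5)) := by
        intro ξ; ring
      simp_rw [e]
      rw [integral_const_mul, integral_coord_sq_mul_norm_sq_sub_five, mul_zero]
    have hi_full : Integrable (fun ξ : V3 => ξ 0 * ξ 0 * (θ p * ‖ξ‖ ^ 2 - 5 * θ p)) (stdGaussian V3) :=
      integrable_coord_mul_weight 0 0 (ω := fun t => θ p * t - 5 * θ p) (by fun_prop) (P := 5 * θM) (hlin p)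
    have hi_def : Integrable (fun ξ : V3 => ξ 0 * ξ 0 *
        ((θ p * ‖ξ‖ ^ 2 - 5 * θ p) * (1 - χ (θ p * ‖ξ‖ ^ 2)))) (stdGaussian V3) := by
      refine integrable_coord_mul_weight 0 0 (ω := fun t => (θ p * t - 5 * θ p) * (1 - χ (θ p * t))) (by fun_prop)
        (P := 5 * θM) fun t ht => ?_
      rw [abs_mul]
      exact (mul_le_mul (hlin p t ht) (h1χ _) (abs_nonneg _) (by positivity)).trans_eq (mul_one _)
    have hsplit : R p = 0 - ∫ ξ : V3, ξ 0 * ξ 0 *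
        ((θ p * ‖ξ‖ ^ 2 - 5 * θ p) * (1 - χ (θ p * ‖ξ‖ ^ 2))) ∂stdGaussian V3 := by
      rw [← hfull, ← integral_sub hi_full hi_def, hR]
      refine integral_congr_ae (ae_of_all _ fun ξ => ?_)
      simp only
      ring
    -- pointwise domination of the defect integrand by the tail weight
    have hdom : ∀ ξ : V3, |ξ 0 * ξ 0 * ((θ p * ‖ξ‖ ^ 2 - 5 * θ p) * (1 - χ (θ p * ‖ξ‖ ^ 2)))| ≤
        5 * θM * Real.exp (-(A * K)) * ((1 + ‖ξ‖ ^ 2) ^ 3 * Real.exp (A * Real.sqrt θM * ‖ξ‖)) := by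
      intro ξ
      by_cases hsh : θ p * ‖ξ‖ ^ 2 ≤ L
      · rw [hχlo _ hsh, sub_self, mul_zero, mul_zero, abs_zero]; positivity
      · have hKs : K ^ 2 ≤ θ p * ‖ξ‖ ^ 2 := by rw [← hL]; exact (not_le.1 hsh).le
        have hone := one_le_exp_rate_of_sq_le h0 (hθM p) hA.le ξ hKs
        have h3 : |ξ 0 * ξ 0 * ((θ p * ‖ξ‖ ^ 2 - 5 * θ p) * (1 - χ (θ p * ‖ξ‖ ^ 2)))| ≤
            1 * 1 * (5 * θM) * (1 + ‖ξ‖ ^ 2) ^ 3 := by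
          refine abs_mul_three_le (abs_coord_le' ξ 0) (abs_coord_le' ξ 0) ?_
          rw [abs_mul]
          exact (mul_le_mul (hlin p _ (sq_nonneg _)) (h1χ _) (abs_nonneg _) (by positivity)).trans_eq (mul_one _)
        have h4 : (1 : ℝ) * 1 * (5 * θM) * (1 + ‖ξ‖ ^ 2) ^ 3 ≤
            1 * 1 * (5 * θM) * (1 + ‖ξ‖ ^ 2) ^ 3 * Real.exp (A * Real.sqrt θM * ‖ξ‖ - A * K) :=
          le_mul_of_one_le_right (by positivity) hone
        have e : (1 : ℝ) * 1 * (5 * θM) * (1 + ‖ξ‖ ^ 2) ^ 3 * Real.exp (A * Real.sqrt θM * ‖ξ‖ - A * K) =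
            5 * θM * Real.exp (-(A * K)) * ((1 + ‖ξ‖ ^ 2) ^ 3 * Real.exp (A * Real.sqrt θM * ‖ξ‖)) := by
          rw [sub_eq_add_neg, Real.exp_add]; ring
        linarith
    have h := norm_integral_le_of_norm_le (μ := stdGaussian V3)
      (f := fun ξ : V3 => ξ 0 * ξ 0 * ((θ p * ‖ξ‖ ^ 2 - 5 * θ p) * (1 - χ (θ p * ‖ξ‖ ^ 2))))
      ((integrable_tailWeight (A * Real.sqrt θM)).const_mul (5 * θM * Real.exp (-(A * K))))
      (ae_of_all (stdGaussian V3) fun ξ => by rw [Real.norm_eq_abs]; exact hdom ξ)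
    rw [Real.norm_eq_abs, integral_const_mul, ← hMexp] at h
    rw [hsplit, zero_sub, abs_neg]
    calc _ ≤ 5 * θM * Real.exp (-(A * K)) * Mexp := h
      _ = 5 * θM * Mexp * Real.exp (-(A * K)) := by ring
  set ρ : X → ℝ := fun p => R p / m₀ with hρ
  have hρc : Continuous ρ := by rw [hρ]; exact hRc.div_const _
  have hρM : ∀ p, |ρ p| ≤ ρM := fun p => by
    rw [hρ, hρMdef]
    dsimp only
    rw [abs_div, abs_of_pos hm₀]
    exact div_le_div_of_nonneg_right (hRbd p) hm₀.le
  have hρtail : ∀ p, |ρ p| ≤ 5 * θM * Mexp / m₀ * Real.exp (-(A * K)) := fun p => by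
    rw [hρ]
    dsimp only
    rw [abs_div, abs_of_pos hm₀, div_mul_eq_mul_div]
    exact div_le_div_of_nonneg_right (hRtail p) hm₀.le
  set Cr : ℝ := 5 * θM * Mexp / m₀ * Real.exp (-(A * K)) with hCr
  have hCr0 : 0 ≤ Cr := by positivity
  clear_value R ρ
  have hr₀a : ∀ t, |r₀ t| ≤ 1 := fun t => by rw [abs_of_nonneg (hr₀0 _)]; exact hr₀1 _
  have hρr : ∀ p t, |ρ p * r₀ t| ≤ Cr := fun p t => by
    rw [abs_mul]; exact (mul_le_mul (hρtail p) (hr₀a t) (abs_nonneg _) hCr0).trans_eq (mul_one _)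
  have hρr' : ∀ p t, |ρ p * r₀ t| ≤ ρM := fun p t => by
    rw [abs_mul]; exact (mul_le_mul (hρM p) (hr₀a t) (abs_nonneg _) hρM0).trans_eq (mul_one _)
  /- Step 5: the profile `G` and its pointwise properties. -/
  set G : X × ℝ → ℝ := fun q => (q.2 - 5 * θ q.1) * χ q.2 - ρ q.1 * r₀ (q.2 / θ q.1) with hG
  have hGc : Continuous G := by
    have hd : Continuous fun q : X × ℝ => q.2 / θ q.1 :=
      continuous_snd.div (hθc.comp continuous_fst) fun q => (hθpos q.1).ne'
    have h1 : Continuous fun q : X × ℝ => (q.2 - 5 * θ q.1) * χ q.2 := by fun_prop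
    rw [hG]
    exact h1.sub ((hρc.comp continuous_fst).mul (hr₀c.comp hd))
  -- the remainder below the level (only the bulk correction) and above it
  have hrem1 : ∀ p s, 0 ≤ s → s ≤ K ^ 2 → |s - 5 * θ p - G (p, s)| ≤ Cr := fun p s _ hs => by
    have e : s - 5 * θ p - G (p, s) = ρ p * r₀ (s / θ p) := by simp only [hG]; rw [hχlo s hs]; ring
    rw [e]; exact hρr p _
  have hrem2 : ∀ p s, K ^ 2 < s → |s - 5 * θ p - G (p, s)| ≤ |s - 5 * θ p| + Cr := fun p s _ => by
    have e : s - 5 * θ p - G (p, s) = (s - 5 * θ p) * (1 - χ s) + ρ p * r₀ (s / θ p) := by simp only [hG]; ring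
    rw [e]
    refine (abs_add_le _ _).trans (add_le_add ?_ (hρr p _))
    rw [abs_mul]
    exact (mul_le_mul_of_nonneg_left (h1χ s) (abs_nonneg _)).trans_eq (mul_one _)
  -- vanishing beyond `S₀ = max (2L) (3θM)` and the sup bound on `s ≥ 0`
  set S₀ : ℝ := max (2 * L) (3 * θM) with hS₀
  have hS₀0 : 0 ≤ S₀ := le_max_of_le_left (by positivity)
  have hGhi : ∀ p s, S₀ ≤ s → G (p, s) = 0 := by
    intro p s hs
    have h1 : 2 * L ≤ s := (le_max_left _ _).trans hs
    have h2 : 1 + 2 ≤ s / θ p := by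
      rw [le_div_iff₀ (hθpos p)]
      calc (1 + 2) * θ p ≤ 3 * θM := by nlinarith [hθM p, hθpos p]
        _ ≤ S₀ := le_max_right _ _
        _ ≤ s := hs
    simp only [hG]
    rw [hχhi s h1, hr₀hi _ h2]; ring
  set CG : ℝ := 2 * L + 5 * θM + ρM with hCG
  have hCG0 : 0 ≤ CG := by rw [hCG]; positivity
  have hGbd : ∀ p s, 0 ≤ s → |G (p, s)| ≤ CG := fun p s hs => by
    simp only [hG]
    exact (abs_sub _ _).trans (add_le_add (hq p s hs) (hρr' p _))
  -- the LINEAR-in-`K` growth of the profile along `s = ‖w‖²`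
  have hGgrowth : ∀ (p : X) (w : V3), |G (p, ‖w‖ ^ 2)| ≤ 2 * K * ‖w‖ + 5 * θM + ρM := by
    intro p w
    have hw0 := norm_nonneg w
    have hcut : |(‖w‖ ^ 2 - 5 * θ p) * χ (‖w‖ ^ 2)| ≤ 2 * K * ‖w‖ + 5 * θM := by
      by_cases h : ‖w‖ ^ 2 ≤ 2 * L
      · have hwK : ‖w‖ ≤ 2 * K :=
          (pow_le_pow_iff_left₀ hw0 (by positivity) two_ne_zero).1
            (h.trans (by rw [hL]; nlinarith [sq_nonneg K]))
        rw [abs_mul, abs_of_nonneg (hχ0 _)]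
        calc |‖w‖ ^ 2 - 5 * θ p| * χ (‖w‖ ^ 2) ≤ |‖w‖ ^ 2 - 5 * θ p| * 1 :=
              mul_le_mul_of_nonneg_left (hχ1 _) (abs_nonneg _)
          _ ≤ ‖w‖ ^ 2 + 5 * θM := by
              rw [mul_one]
              refine (abs_sub _ _).trans ?_
              rw [abs_of_nonneg (by positivity), abs_of_nonneg (by have := hθpos p; positivity)]
              linarith [hθM p]
          _ ≤ 2 * K * ‖w‖ + 5 * θM := by nlinarith
      · rw [hχhi _ (not_le.1 h).le, mul_zero, abs_zero]; positivity
    simp only [hG]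
    exact (abs_sub _ _).trans (add_le_add hcut (hρr' p _))
  /- Step 6: the scalar re-orthogonalisation identity `E[ξ₀² G(p, θ(p)‖ξ‖²)] = R − ρ m₀ = 0`. -/
  have hscalar : ∀ p, ∫ ξ : V3, ξ 0 * ξ 0 * G (p, θ p * ‖ξ‖ ^ 2) ∂stdGaussian V3 = 0 := by
    intro p
    have hGsh : ∀ ξ : V3, ξ 0 * ξ 0 * G (p, θ p * ‖ξ‖ ^ 2) =
        ξ 0 * ξ 0 * ((θ p * ‖ξ‖ ^ 2 - 5 * θ p) * χ (θ p * ‖ξ‖ ^ 2)) -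
          ρ p * (ξ 0 * ξ 0 * r₀ (‖ξ‖ ^ 2)) := by
      intro ξ; simp only [hG]; rw [mul_div_cancel_left₀ _ (hθpos p).ne']; ring
    have hi1 : Integrable (fun ξ : V3 => ξ 0 * ξ 0 *
        ((θ p * ‖ξ‖ ^ 2 - 5 * θ p) * χ (θ p * ‖ξ‖ ^ 2))) (stdGaussian V3) :=
      integrable_coord_mul_weight 0 0 (ω := fun t => (θ p * t - 5 * θ p) * χ (θ p * t))
        (by fun_prop) (P := 5 * θM) (hqlin p)
    simp_rw [hGsh]
    rw [integral_sub hi1 (hir₀.const_mul _), integral_const_mul, ← hm₀def, hρ,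
      div_mul_cancel₀ _ hm₀.ne', sub_eq_zero, hR]
  /- Step 7: assembly (orthogonality by `odd_member_orth`; growth by Cauchy–Schwarz). -/
  have horth := fun p => odd_member_orth (hθpos p) (u p) (b p) (Gx := fun s => G (p, s))
    (by fun_prop) (C := CG) (fun s hs => hGbd p s hs) hS₀0 (fun s hs => hGhi p s hs) (hscalar p)
  refine ⟨G, hGc, ⟨CG, fun y hy => hGbd y.1 y.2 hy⟩, hrem1, hrem2, fun p v => ?_,
    fun p => (horth p).1, fun p k => (horth p).2.1 k, fun p => (horth p).2.2⟩
  have hin : inner ℝ (b p) (v - u p) = ∑ j, b p j * (v - u p) j := by simp [PiLp.inner_apply, mul_comm]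
  have h1 : |∑ j, b p j * (v - u p) j| ≤ Bb * ‖v - u p‖ := by
    rw [← hin]
    exact (abs_real_inner_le_norm _ _).trans (mul_le_mul_of_nonneg_right (hBb p) (norm_nonneg _))
  have h2 := hGgrowth p (v - u p)
  have hw : ‖v - u p‖ ^ 2 ≤ 2 * ‖v‖ ^ 2 + 2 * U ^ 2 := by
    have h3 := norm_sub_le v (u p)
    have h4 : ‖u p‖ ^ 2 ≤ U ^ 2 := pow_le_pow_left₀ (norm_nonneg _) (hU p) 2
    nlinarith [norm_nonneg (v - u p), norm_nonneg v, norm_nonneg (u p), sq_nonneg (‖v‖ - ‖u p‖)]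
  have hwn := norm_nonneg (v - u p)
  have h3 := growth_arith hwn hK0 (add_nonneg (by positivity : (0 : ℝ) ≤ 5 * θM) hρM0) hw
  rw [abs_mul]
  calc |∑ j, b p j * (v - u p) j| * |G (p, ‖v - u p‖ ^ 2)|
      ≤ Bb * ‖v - u p‖ * (2 * K * ‖v - u p‖ + 5 * θM + ρM) := mul_le_mul h1 h2 (abs_nonneg _) (by positivity)
    _ = Bb * (‖v - u p‖ * (2 * K * ‖v - u p‖ + (5 * θM + ρM))) := by ring
    _ ≤ Bb * ((2 * K + (5 * θM + ρM)) * ((2 + 2 * U ^ 2) * (1 + ‖v‖ ^ 2))) := mul_le_mul_of_nonneg_left h3 hBb0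
    _ = (2 * Bb * (2 + 2 * U ^ 2) * K + Bb * (2 + 2 * U ^ 2) * (5 * θM + ρM)) * (1 + ‖v‖ ^ 2) := by ring
end Summit.AtomisticToContinuum.HydrodynamicLimit.Theorems.TransferEntropyClockTailRateCutoff

end
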